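import Summits.AtomisticToContinuum.Crystallization.Theorems.FreeSplittingCertificatesStrictSplittingRuleTorusModel442Forms

/-!
# Torus model 4×4×2: the transfers sum to zero over the torus (`Σ_p T_p(u) = 0`, checked in Lean)

Route `FreeSplittingCertificates`, crux `StrictSplittingRule` (stmt-AtomisticToContinuum-12560); unit b2b-freesplit-B (block 2b,
PART B, gen 1).  VALUE = fidelity of a FINITE model — NOT summit progress.

The transfer format of `CoreJointCoercive` is antisymmetric: what a pair class adds to the first site's ledger it subtracts from
the partner's, so summed over all sites the transfers vanish and the sitewise inequalities add up to a statement about the bare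
second variation alone (CERT.md §1).  For the Lean model (`transferTerms` of `…TorusModel442Defs.lean`, tables
`tableClasses`) this is CHECKED here: the Gram matrix assembled from the transfer terms of all 64 sites is identically zero
(`transferSum_gram_zero`, `native_decide`), hence `transfer_sum_zero : ∀ u, ∑ p : Site, transfer p u = 0`.
COMPUTATIONAL regime (`native_decide`, `Lean.ofReduceBool`). [folklore]
-/

namespace Summit.AtomisticToContinuum.Crystallization.Theorems.StrictSplittingRuleTorusLMI

open Literature.Computation.Certificates

/-- The transfer terms of all 64 sites, concatenated. [folklore] -/
def allTransferTerms : List (Term 192) := allSites.flatMap fun p => transferTerms p tableClasses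

/-- Their assembled Gram matrix (a `Vector`, computed once). [folklore] -/
def allTransferAcc : Acc 192 := assemble allTransferTerms

/-- **Check**: the assembled Gram matrix of all transfer terms is identically zero.  COMPUTATIONAL (`native_decide`). -/
theorem transferSum_gram_zero : ∀ i j : Fin 192, allTransferAcc.toMatrix i j = 0 := by
  native_decide

/-- **The transfers sum to zero over the torus**: `Σ_{p ∈ T} T_p(u) = 0` for every displacement field `u`. -/
theorem transfer_sum_zero (u : Fin 192 → ℚ) : ∑ p : Site, transfer p u = 0 := by
  have h1 : ∑ p : Site, transfer p u = evalQ allTransferTerms u := by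
    unfold allTransferTerms transfer
    rw [evalQ_flatMap, ← allSites_sum]
  rw [h1, evalQ_eq_quadForm, ← toMatrix_assemble]
  refine Finset.sum_eq_zero fun i _ => Finset.sum_eq_zero fun j _ => ?_
  rw [show (assemble allTransferTerms).toMatrix i j = allTransferAcc.toMatrix i j from rfl, transferSum_gram_zero i j]
  ring

end Summit.AtomisticToContinuum.Crystallization.Theorems.StrictSplittingRuleTorusLMI
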